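import Literature.NumberTheory.Sieve.SmoothParityAsymptoticExplicit
import Literature.NumberTheory.Sieve.SmoothParityAsymptoticRates
import Literature.NumberTheory.Sieve.SmoothTwistedSaddleWindowLong
import Literature.NumberTheory.Sieve.SmoothZetaDecayLongRange
import HarnessLib

/-!
# Parity-class friable ternary counts: the zeroth-order asymptotic (ε-form)

Topic `Literature/NumberTheory/Sieve`, namespace `Literature.NumberTheory.Sieve.SmoothArcs`; a PROVED file — the goal of the
circle-method engine `SmoothParityTernary` … `SmoothParityAsymptoticExplicit` ([Harper2016, §5], [LagariasSoundararajan2012,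
Thm 1.3]).  In the polylog regime `y = ⌊(log x)^{100000}⌋` (TIED to `x`), with `α = α(x, y)`, `𝓜 = x^αζ(α,y)/√(2πφ₂(α,y))`,
`Mv_i = e_i^{−α}𝓜`: given the GRH-type currency for non-principal friable character sums (hF) and the long-range decay of
`ζ(α+it,y)/ζ(α,y)` (`FriableZetaLongRangeDecay`, also a consequence of GRH), for fixed `D₀, B ≤ 9000, H₀, P₀` and `ε > 0`,
for all large `x` and ALL data with `σ = ±1`, scalings `1 ≤ e_i ≤ (log x)^B`, dilations `d₁` even, `d₂` odd, `d_i ≤ D₀`,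
`d₁/e₁ + d₂/e₂ + 1/e₃ ≤ 1`, cube-summable profiles with `‖c_i‖_W ≤ P₀`, `|p_{c_i}| ≤ 1`, and majorant sums `𝓗₃(R) ≤ H₀`
(uniformly in `R`; `SmoothParityHcCrude`/`…HcSum` bound them for the parity classes):

`‖parityTernarySum y σ d₁ d₂ (x/e₁) (x/e₂) (x/e₃) c₁ c₂ c₃ − paritySingSeries α σ d₁ d₂ · parityModelCount …‖ ≤ ε · Mv₁Mv₂Mv₃/(x/e₃)`

(`parityTernary_asymptotic`).  Proof: `parityTernary_explicit` with `R = ⌊(log x)^{10B+300}⌋`, `Λ = R⁴`,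
`E = (log x)^{B+2r+3}`, `η = C_W(B'+1)² log y/log x` from `scaledSum_main_term_quant_long`, `ε₀ = 1/100`,
`G₀ = x^{1−10⁻⁴}/(√(6π) log x)`, `Φ = 3 log²x`, the regime facts `polylog_regime_basic` / `polylog_regime_real_scales`, and the
decay `major_rate` / `minor_rate` of the flat errors along the gauge `g → 0`.

## References

* A. J. Harper, Compositio Math. 152 (2016), §5 [Harper2016].
* J. C. Lagarias, K. Soundararajan, Proc. LMS 104 (2012), Thm 1.3 [LagariasSoundararajan2012].
-/

noncomputable section

open Finset Real Complex Filter Topology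

namespace Literature.NumberTheory.Sieve

namespace SmoothArcs

open TwistedWeight

/-! ### Eventual facts along `x → ∞` -/

/-- `(log x)^n ≤ c x^s` eventually, for `s, c > 0`. [folklore] -/
theorem eventually_log_pow_le_mul_rpow (n : ℕ) {s c : ℝ} (hs : 0 < s) (hc : 0 < c) :
    ∀ᶠ x : ℝ in atTop, Real.log x ^ n ≤ c * x ^ s := by
  have h := (isLittleO_log_rpow_rpow_atTop (n : ℝ) hs).def hc
  filter_upwards [h, eventually_ge_atTop (1 : ℝ)] with x hx hx1
  rw [Real.rpow_natCast, Real.norm_of_nonneg (pow_nonneg (Real.log_nonneg hx1) _),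
    Real.norm_of_nonneg (Real.rpow_nonneg (by linarith) _)] at hx
  exact hx

/-- The gauge `g(x) = (log log x)²/log x + (log x)^{−1/6} + (log x)^N x^{−1/20} → 0`. [folklore] -/
theorem tendsto_gauge (N : ℕ) :
    Tendsto (fun x : ℝ => Real.log (Real.log x) ^ 2 / Real.log x + Real.log x ^ (-(1 / 6 : ℝ)) +
      Real.log x ^ N * x ^ (-(1 / 20 : ℝ))) atTop (𝓝 0) := by
  have h3 : Tendsto (fun x : ℝ => Real.log x ^ N * x ^ (-(1 / 20 : ℝ))) atTop (𝓝 0) := by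
    have h := (isLittleO_log_rpow_rpow_atTop (N : ℝ) (show (0 : ℝ) < 1 / 20 by norm_num)).tendsto_div_nhds_zero
    refine h.congr' ?_
    filter_upwards [eventually_gt_atTop (0 : ℝ)] with x hx
    rw [Real.rpow_natCast, Real.rpow_neg hx.le, div_eq_mul_inv]
  have := (tendsto_loglog_sq_div_log.add (tendsto_log_rpow_neg (show (0 : ℝ) < 1 / 6 by norm_num))).add h3
  simpa using this

/-- The level `R = ⌊L^r⌋`: `L^r/2 ≤ R ≤ L^r ≤ R + 1`, `2 ≤ R`, and `R/L^B ≥ L^{r−B}/2 ≥ L^B`… (`L ≥ 2`, `r = 10B+300`).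
[folklore] -/
theorem level_facts {L : ℝ} (hL : 2 ≤ L) (B : ℕ) :
    L ^ (10 * B + 300) / 2 ≤ (⌊L ^ (10 * B + 300)⌋₊ : ℝ) ∧ (⌊L ^ (10 * B + 300)⌋₊ : ℝ) ≤ L ^ (10 * B + 300) ∧
      L ^ (10 * B + 300) ≤ (⌊L ^ (10 * B + 300)⌋₊ : ℝ) + 1 ∧ 2 ≤ ⌊L ^ (10 * B + 300)⌋₊ ∧
      L ^ (9 * B + 300) / 2 ≤ (⌊L ^ (10 * B + 300)⌋₊ : ℝ) / L ^ B ∧ L ^ B ≤ (⌊L ^ (10 * B + 300)⌋₊ : ℝ) ∧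
      192 * (⌊L ^ (10 * B + 300)⌋₊ : ℝ) ≤ (⌊L ^ (10 * B + 300)⌋₊ : ℝ) ^ 4 := by
  have hL1 : 1 ≤ L := by linarith
  have hL0 : 0 ≤ L := by linarith
  set T : ℝ := L ^ (10 * B + 300) with hT
  have hfl : T - 1 < ⌊T⌋₊ := by have := Nat.lt_floor_add_one T; linarith
  have hflle : (⌊T⌋₊ : ℝ) ≤ T := Nat.floor_le (by positivity)
  have hsplit : T = L ^ B * L ^ (9 * B + 300) := by rw [hT, ← pow_add]; exact congrArg (L ^ ·) (by omega)
  have h9 : (2 : ℝ) ^ 9 ≤ L ^ (9 * B + 300) := (pow_le_pow_left₀ zero_le_two hL 9).trans (pow_le_pow_right₀ hL1 (by omega))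
  have hLB : 1 ≤ L ^ B := one_le_pow₀ hL1
  have hT512 : 512 ≤ T := by rw [hsplit]; nlinarith
  have hRlo : T / 2 ≤ ⌊T⌋₊ := by linarith
  refine ⟨hRlo, hflle, by linarith, ?_, ?_, ?_, ?_⟩
  · exact_mod_cast (show (2 : ℝ) ≤ ⌊T⌋₊ by linarith)
  · rw [le_div_iff₀ (by positivity)]
    calc L ^ (9 * B + 300) / 2 * L ^ B = T / 2 := by rw [hsplit]; ring
      _ ≤ _ := hRlo
  · have : L ^ B * 2 ≤ T := by rw [hsplit]; nlinarith
    linarith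
  · have hR6 : (6 : ℝ) ≤ ⌊T⌋₊ := by linarith
    calc 192 * (⌊T⌋₊ : ℝ) ≤ 6 ^ 3 * (⌊T⌋₊ : ℝ) := by nlinarith
      _ ≤ (⌊T⌋₊ : ℝ) ^ 3 * ⌊T⌋₊ := mul_le_mul_of_nonneg_right (pow_le_pow_left₀ (by norm_num) hR6 3) (by linarith)
      _ = _ := by ring

/-! ### The theorem -/

set_option maxHeartbeats 3200000 in
/-- **THE ZEROTH-ORDER ASYMPTOTIC FOR PARITY-CLASS FRIABLE TERNARY COUNTS (ε-form, polylog regime, bounded dilations,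
polylog scalings).**  See the module docstring. [cite: LagariasSoundararajan2012, Thm 1.3 (shape)] [cite: Harper2016, §5] -/
theorem parityTernary_asymptotic
    (hF : ∀ ε : ℝ, 0 < ε → ∃ C : ℝ, 0 < C ∧ ∀ (q : ℕ) (χ : DirichletCharacter ℂ q), q ≠ 0 → χ ≠ 1 →
      ∀ (y : ℕ) (X lam : ℝ), 1 ≤ X →
        ‖∑ n ∈ Nat.smoothNumbersUpTo ⌊X⌋₊ (y + 1), χ (n : ZMod q) * twistWeight lam (n / X)‖ ≤
          C * (1 + |lam|) ^ 3 * X ^ (1 / 2 + ε) * (q : ℝ) ^ ε)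
    (hD : FriableZetaLongRangeDecay) (D₀ B : ℕ) (hB : B ≤ 9000) (H₀ P₀ ε : ℝ) (hε : 0 < ε) :
    ∀ᶠ x : ℝ in atTop, ∀ (σ : ℤ) (e₁ e₂ e₃ d₁ d₂ : ℕ) (c₁ c₂ c₃ : ℤ → ℂ),
      (σ = 1 ∨ σ = -1) → 1 ≤ e₁ → 1 ≤ e₂ → 1 ≤ e₃ →
      (e₁ : ℝ) ≤ Real.log x ^ B → (e₂ : ℝ) ≤ Real.log x ^ B → (e₃ : ℝ) ≤ Real.log x ^ B →
      1 ≤ d₁ → 1 ≤ d₂ → d₁ ≤ D₀ → d₂ ≤ D₀ → Even d₁ → Odd d₂ →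
      (d₁ : ℝ) / e₁ + d₂ / e₂ + 1 / e₃ ≤ 1 →
      Summable (fun ℓ : ℤ => ‖c₁ ℓ‖ * (1 + |(ℓ : ℝ)|) ^ 3) → Summable (fun ℓ : ℤ => ‖c₂ ℓ‖ * (1 + |(ℓ : ℝ)|) ^ 3) →
      Summable (fun ℓ : ℤ => ‖c₃ ℓ‖ * (1 + |(ℓ : ℝ)|) ^ 3) →
      profileNorm c₁ ≤ P₀ → profileNorm c₂ ≤ P₀ → profileNorm c₃ ≤ P₀ →
      (∀ v : ℝ, ‖profileFn c₁ v‖ ≤ 1) → (∀ v : ℝ, ‖profileFn c₂ v‖ ≤ 1) → (∀ v : ℝ, ‖profileFn c₃ v‖ ≤ 1) →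
      (∀ R : ℕ, ∑ k ∈ Icc 1 R, ∑ a ∈ (Finset.range k).filter (Nat.Coprime k),
        classLocalHc (saddlePoint x ⌊Real.log x ^ 100000⌋₊) 2 1 k (d₁ * a) *
          classLocalHc (saddlePoint x ⌊Real.log x ^ 100000⌋₊) 2 1 k (σ * (d₂ * a)) *
          classLocalHc (saddlePoint x ⌊Real.log x ^ 100000⌋₊) 1 0 k a ≤ H₀) →
      ‖parityTernarySum ⌊Real.log x ^ 100000⌋₊ σ d₁ d₂ (x / e₁) (x / e₂) (x / e₃) c₁ c₂ c₃ -
          paritySingSeries (saddlePoint x ⌊Real.log x ^ 100000⌋₊) σ d₁ d₂ *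
            parityModelCount σ d₁ d₂ (x / e₁) (x / e₂) (x / e₃)
              ((e₁ : ℝ) ^ (-saddlePoint x ⌊Real.log x ^ 100000⌋₊) *
            (x ^ saddlePoint x ⌊Real.log x ^ 100000⌋₊ * smoothZeta (saddlePoint x ⌊Real.log x ^ 100000⌋₊) ⌊Real.log x ^ 100000⌋₊ /
              Real.sqrt (2 * Real.pi * saddlePhi₂ (saddlePoint x ⌊Real.log x ^ 100000⌋₊) ⌊Real.log x ^ 100000⌋₊)))
              ((e₂ : ℝ) ^ (-saddlePoint x ⌊Real.log x ^ 100000⌋₊) *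
            (x ^ saddlePoint x ⌊Real.log x ^ 100000⌋₊ * smoothZeta (saddlePoint x ⌊Real.log x ^ 100000⌋₊) ⌊Real.log x ^ 100000⌋₊ /
              Real.sqrt (2 * Real.pi * saddlePhi₂ (saddlePoint x ⌊Real.log x ^ 100000⌋₊) ⌊Real.log x ^ 100000⌋₊)))
              ((e₃ : ℝ) ^ (-saddlePoint x ⌊Real.log x ^ 100000⌋₊) *
            (x ^ saddlePoint x ⌊Real.log x ^ 100000⌋₊ * smoothZeta (saddlePoint x ⌊Real.log x ^ 100000⌋₊) ⌊Real.log x ^ 100000⌋₊ /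
              Real.sqrt (2 * Real.pi * saddlePhi₂ (saddlePoint x ⌊Real.log x ^ 100000⌋₊) ⌊Real.log x ^ 100000⌋₊)))
              (saddlePoint x ⌊Real.log x ^ 100000⌋₊) c₁ c₂ c₃‖ ≤
        ε * (((e₁ : ℝ) ^ (-saddlePoint x ⌊Real.log x ^ 100000⌋₊) *
            (x ^ saddlePoint x ⌊Real.log x ^ 100000⌋₊ * smoothZeta (saddlePoint x ⌊Real.log x ^ 100000⌋₊) ⌊Real.log x ^ 100000⌋₊ /
              Real.sqrt (2 * Real.pi * saddlePhi₂ (saddlePoint x ⌊Real.log x ^ 100000⌋₊) ⌊Real.log x ^ 100000⌋₊))) *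
          ((e₂ : ℝ) ^ (-saddlePoint x ⌊Real.log x ^ 100000⌋₊) *
            (x ^ saddlePoint x ⌊Real.log x ^ 100000⌋₊ * smoothZeta (saddlePoint x ⌊Real.log x ^ 100000⌋₊) ⌊Real.log x ^ 100000⌋₊ /
              Real.sqrt (2 * Real.pi * saddlePhi₂ (saddlePoint x ⌊Real.log x ^ 100000⌋₊) ⌊Real.log x ^ 100000⌋₊))) *
          ((e₃ : ℝ) ^ (-saddlePoint x ⌊Real.log x ^ 100000⌋₊) *
            (x ^ saddlePoint x ⌊Real.log x ^ 100000⌋₊ * smoothZeta (saddlePoint x ⌊Real.log x ^ 100000⌋₊) ⌊Real.log x ^ 100000⌋₊ /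
              Real.sqrt (2 * Real.pi * saddlePhi₂ (saddlePoint x ⌊Real.log x ^ 100000⌋₊) ⌊Real.log x ^ 100000⌋₊)))) / (x / e₃) := by
  -- ### constants
  obtain ⟨C_F, hC_F, hFb⟩ := hF (1 / 100) (by norm_num)
  obtain ⟨C_W, hC_W, hWin⟩ := scaledSum_main_term_quant_long hD
  obtain ⟨x_W, hWx⟩ := hWin (B + 2 * (10 * B + 300) + 3)
  obtain ⟨C_E, x_E, hC_E, hEXP⟩ := parityTernary_explicit
  obtain ⟨C_sc, x_sc, -, hSC⟩ := scale_compare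
  obtain ⟨x₁, hlt1⟩ := saddlePoint_lt_one
  set P : ℝ := max P₀ 1 with hPdef
  set H : ℝ := max H₀ 1 with hHdef
  set D : ℝ := max (D₀ : ℝ) 1 with hDdef
  have hP1 : 1 ≤ P := le_max_right _ _
  have hH1 : 1 ≤ H := le_max_right _ _
  have hD1 : 1 ≤ D := le_max_right _ _
  obtain ⟨A_M, hA_M0, hMAJR⟩ := major_rate B hP1 hH1 hD1 hC_F.le hC_W.le
  obtain ⟨A_m, hA_m0, hMINR⟩ := minor_rate B hP1 hC_E.le
  -- ### eventual facts
  have hg := tendsto_gauge (23 * (10 * B + 300) + 3 * B + 200051)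
  have Eg1 : ∀ᶠ x : ℝ in atTop, A_M * (Real.log (Real.log x) ^ 2 / Real.log x + Real.log x ^ (-(1 / 6 : ℝ)) +
      Real.log x ^ (23 * (10 * B + 300) + 3 * B + 200051) * x ^ (-(1 / 20 : ℝ))) < min (ε / 2) 1 := by
    have h := hg.const_mul A_M
    rw [mul_zero] at h
    exact (tendsto_order.1 h).2 _ (lt_min (by linarith) one_pos)
  have Eg2 : ∀ᶠ x : ℝ in atTop, A_m * (Real.log (Real.log x) ^ 2 / Real.log x + Real.log x ^ (-(1 / 6 : ℝ)) +
      Real.log x ^ (23 * (10 * B + 300) + 3 * B + 200051) * x ^ (-(1 / 20 : ℝ))) < ε ^ 2 / (4 * C_E ^ 2) := by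
    have h := hg.const_mul A_m
    rw [mul_zero] at h
    exact (tendsto_order.1 h).2 _ (by positivity)
  have EL : ∀ᶠ x : ℝ in atTop, 3 ≤ Real.log x := Real.tendsto_log_atTop.eventually_ge_atTop _
  have E107 : ∀ᶠ x : ℝ in atTop, ((⌈Real.exp 107⌉₊ : ℕ) : ℝ) ≤ Real.log x ^ 8 :=
    ((tendsto_pow_atTop (by norm_num : (8 : ℕ) ≠ 0)).comp Real.tendsto_log_atTop).eventually_ge_atTop _
  have ED : ∀ᶠ x : ℝ in atTop, D ^ 2 + 1 ≤ x := eventually_ge_atTop _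
  have Ex : ∀ᶠ x : ℝ in atTop, max x_W (max x_sc x₁) ≤ x := eventually_ge_atTop _
  have EBsqrt := eventually_log_pow_le_mul_rpow B (show (0 : ℝ) < 1 / 2 by norm_num) one_pos
  have E3r := eventually_log_pow_le_mul_rpow (3 * (10 * B + 300)) one_pos (show (0 : ℝ) < 1 / 800 by norm_num)
  have E10 := eventually_log_pow_le_mul_rpow (10 * B + 300) (show (0 : ℝ) < 1 / 10 by norm_num) one_pos
  have E4r := eventually_log_pow_le_mul_rpow (4 * (10 * B + 300) + B) one_pos one_pos
  filter_upwards [polylog_regime_basic, polylog_regime_real_scales x_E, Eg1, Eg2, EL, E107, ED, Ex, EBsqrt, E3r, E10, E4r]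
    with x hb hreg hg1 hg2 hL3 h107 hDx hxm hBsq h3r h10 h4r σ e₁ e₂ e₃ d₁ d₂ c₁ c₂ c₃ hσ he₁ he₂ he₃ heB₁ heB₂ heB₃
    hd₁ hd₂ hdD₁ hdD₂ hd₁e hd₂o hde hc₁ hc₂ hc₃ hP₁ hP₂ hP₃ hp₁ hp₂ hp₃ hHsum
  -- ### unpack the regime
  obtain ⟨hx1, hL2, hy2, hyK', hyK, hy4, hy8x, hlogy6, hlogy5, h200, hsqx⟩ := hb
  simp only [max_le_iff] at hxm
  obtain ⟨hxW, hxsc, hx₁⟩ := hxm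
  set L : ℝ := Real.log x with hL
  set y : ℕ := ⌊L ^ 100000⌋₊ with hy
  have hx0 : 0 < x := by linarith
  have hL1 : 1 ≤ L := by linarith
  have hL0 : 0 < L := by linarith
  have hy1 : 1 ≤ y := by omega
  have hy1r : (1 : ℝ) ≤ y := by exact_mod_cast hy1
  have hy0 : (0 : ℝ) < y := by linarith
  set α : ℝ := saddlePoint x y with hαdef
  -- the master saddle point: `1 - 10⁻⁴ ≤ α < 1`
  obtain ⟨-, -, -, -, hα4, -, -, -⟩ := hreg x hsqx le_rfl
  have hα1 : α < 1 := by
    refine hlt1 x y hx₁ ((pow_le_pow_right₀ hL1 (by norm_num)).trans hy4) ?_ ?_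
    · exact le_trans (le_trans (le_self_pow₀ hy1r (by norm_num)) h200) hsqx
    · have : (0 : ℝ) ≤ L ^ (1 / 6 : ℝ) := Real.rpow_nonneg hL0.le _
      linarith
  have hα13 : 13 / 15 < α := by linarith
  -- scalings
  obtain ⟨he₁1, he₂1, he₃1⟩ : (1 : ℝ) ≤ e₁ ∧ (1 : ℝ) ≤ e₂ ∧ (1 : ℝ) ≤ e₃ :=
    ⟨by exact_mod_cast he₁, by exact_mod_cast he₂, by exact_mod_cast he₃⟩
  obtain ⟨he₁0, he₂0, he₃0⟩ : (0 : ℝ) < e₁ ∧ (0 : ℝ) < e₂ ∧ (0 : ℝ) < e₃ := ⟨by linarith, by linarith, by linarith⟩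
  have hLB1 : 1 ≤ L ^ B := one_le_pow₀ hL1
  have heBx : L ^ B ≤ x ^ (1 / 2 : ℝ) := by simpa using hBsq
  -- the three scales lie in `[√x, x]`
  have hscale : ∀ {e : ℕ}, 1 ≤ e → (e : ℝ) ≤ L ^ B → x ^ (1 / 2 : ℝ) ≤ x / e ∧ x / e ≤ x := by
    intro e he heB
    have he0 : (0 : ℝ) < e := by exact_mod_cast (show 0 < e by omega)
    refine ⟨?_, div_le_self hx0.le (by exact_mod_cast he)⟩
    rw [le_div_iff₀ he0]
    calc x ^ (1 / 2 : ℝ) * e ≤ x ^ (1 / 2 : ℝ) * x ^ (1 / 2 : ℝ) :=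
          mul_le_mul_of_nonneg_left (heB.trans heBx) (Real.rpow_nonneg hx0.le _)
      _ = x := by rw [← Real.rpow_add hx0]; norm_num
  obtain ⟨hx₁E, hy8₁, hy6₁, hy200₁, hα₁, hΨ₁, -, -⟩ := hreg (x / e₁) (hscale he₁ heB₁).1 (hscale he₁ heB₁).2
  obtain ⟨hx₂E, hy8₂, hy6₂, hy200₂, hα₂, hΨ₂, -, -⟩ := hreg (x / e₂) (hscale he₂ heB₂).1 (hscale he₂ heB₂).2
  obtain ⟨hx₃E, hy8₃, hy6₃, hy200₃, hα₃, hΨ₃, hy8₃', hα'⟩ := hreg (x / e₃) (hscale he₃ heB₃).1 (hscale he₃ heB₃).2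
  obtain ⟨hxE, -, -, -, -, -, -, -⟩ := hreg x hsqx le_rfl
  have hy107 : ⌈Real.exp 107⌉₊ ≤ y := by exact_mod_cast h107.trans hy8x
  -- dilations
  have hd₁D : (d₁ : ℝ) ≤ D := le_trans (by exact_mod_cast hdD₁) (le_max_left _ _)
  have hd₂D : (d₂ : ℝ) ≤ D := le_trans (by exact_mod_cast hdD₂) (le_max_left _ _)
  -- ### the level `R`, `Λ = R⁴`, `E`, `η`
  obtain ⟨hRlo, hRhi, hRfl, hR2, hRb, heBR, hΛR⟩ := level_facts hL2 B
  set R : ℕ := ⌊L ^ (10 * B + 300)⌋₊ with hRdef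
  have hR1 : (1 : ℝ) ≤ R := by exact_mod_cast (show 1 ≤ R by omega)
  have hR0 : (0 : ℝ) < R := by linarith
  have hRy : R ≤ y := Nat.floor_le_floor (pow_le_pow_right₀ hL1 (by omega))
  have hRx : 400 * (R : ℝ) ^ 3 < x := by
    have h1 : (R : ℝ) ^ 3 ≤ L ^ (3 * (10 * B + 300)) := by
      rw [mul_comm 3, pow_mul]; exact pow_le_pow_left₀ hR0.le hRhi 3
    rw [Real.rpow_one] at h3r
    linarith
  have hRx10 : (R : ℝ) ≤ x ^ (1 / 10 : ℝ) := hRhi.trans (by simpa using h10)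
  have hΛx : (R : ℝ) ^ 4 ≤ x / L ^ B := by
    rw [le_div_iff₀ (by positivity), Real.rpow_one] at *
    calc (R : ℝ) ^ 4 * L ^ B ≤ L ^ (4 * (10 * B + 300)) * L ^ B := by
          refine mul_le_mul_of_nonneg_right ?_ (by positivity)
          rw [mul_comm 4, pow_mul]; exact pow_le_pow_left₀ hR0.le hRhi 4
      _ = L ^ (4 * (10 * B + 300) + B) := by rw [← pow_add]
      _ ≤ x := by simpa using h4r
  have hΛy : (R : ℝ) ^ 4 ≤ (y : ℝ) ^ 7 := by
    have h1 : (R : ℝ) ^ 4 ≤ L ^ (4 * (10 * B + 300)) := by rw [mul_comm 4, pow_mul]; exact pow_le_pow_left₀ hR0.le hRhi 4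
    have h2 : (L ^ 100000) ^ 7 ≤ 2 ^ 7 * (y : ℝ) ^ 7 := by
      rw [← mul_pow]; exact pow_le_pow_left₀ (by positivity) (by linarith) 7
    have h3 : L ^ (4 * (10 * B + 300)) * 2 ^ 7 ≤ (L ^ 100000) ^ 7 := by
      have hsplit : (L ^ 100000) ^ 7 = L ^ (4 * (10 * B + 300)) * L ^ (700000 - 4 * (10 * B + 300)) := by
        rw [← pow_mul, ← pow_add]; exact congrArg (L ^ ·) (by omega)
      rw [hsplit]
      refine mul_le_mul_of_nonneg_left ?_ (by positivity)
      exact (pow_le_pow_left₀ zero_le_two hL2 7).trans (pow_le_pow_right₀ hL1 (by omega))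
    have h5 : 0 ≤ (y : ℝ) ^ 7 := by positivity
    nlinarith
  have hΛ1 : (1 : ℝ) ≤ (R : ℝ) ^ 4 := one_le_pow₀ hR1
  -- the window hypothesis from the long-range saddle-point theorem
  have hW := hWx x y hxW hy4 hlogy5 ((R : ℝ) ^ 4) hΛ1 hΛy
  -- `E = L^{B'}`
  have hE : ∀ {e : ℕ} {k : ℕ}, (e : ℝ) ≤ L ^ B → k ≤ 2 * R → ((e * k ^ 2 : ℕ) : ℝ) ≤ L ^ (B + 2 * (10 * B + 300) + 3) := by
    intro e k he hk
    have hk' : (k : ℝ) ≤ 2 * R := by exact_mod_cast hk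
    have hk2 : (k : ℝ) ^ 2 ≤ 4 * L ^ (2 * (10 * B + 300)) := by
      calc (k : ℝ) ^ 2 ≤ (2 * R) ^ 2 := pow_le_pow_left₀ (Nat.cast_nonneg _) hk' 2
        _ = 4 * (R : ℝ) ^ 2 := by ring
        _ ≤ 4 * L ^ (2 * (10 * B + 300)) := by
            rw [mul_comm 2 (10 * B + 300), pow_mul]
            exact mul_le_mul_of_nonneg_left (pow_le_pow_left₀ hR0.le hRhi 2) (by norm_num)
    have h8 : (4 : ℝ) ≤ L ^ 3 := by have := pow_le_pow_left₀ zero_le_two hL2 3; norm_num at this; linarith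
    push_cast
    calc (e : ℝ) * (k : ℝ) ^ 2 ≤ L ^ B * (4 * L ^ (2 * (10 * B + 300))) := mul_le_mul he hk2 (by positivity) (by positivity)
      _ ≤ L ^ B * (L ^ 3 * L ^ (2 * (10 * B + 300))) := by gcongr
      _ = L ^ (B + 2 * (10 * B + 300) + 3) := by rw [← pow_add, ← pow_add]; exact congrArg (L ^ ·) (by omega)
  have hE₁ := hE (k := 2 * R) heB₁ le_rfl
  have hE₂ := hE (k := 2 * R) heB₂ le_rfl
  have hE₃ := hE (k := R) heB₃ (by omega)
  -- ### the lower bound `G₀ ≤ 𝓜` and `φ₂ ≤ 3L²`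
  obtain ⟨-, -, hα0, hφ0, hφ3, -⟩ := hSC x y hxsc hy4 hlogy5
  have hlogyL : Real.log y ≤ L := by
    have : L ^ (1 / 5 : ℝ) ≤ L ^ (1 : ℝ) := Real.rpow_le_rpow_of_exponent_le hL1 (by norm_num)
    rw [Real.rpow_one] at this
    exact hlogy5.trans this
  have hlogy0 : 0 ≤ Real.log y := Real.log_nonneg hy1r
  have hΦ : saddlePhi₂ α y ≤ 3 * L ^ 2 := by
    calc saddlePhi₂ α y ≤ 3 * L * Real.log y := hφ3
      _ ≤ 3 * L * L := mul_le_mul_of_nonneg_left hlogyL (by positivity)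
      _ = 3 * L ^ 2 := by ring
  have hS60 : 0 < Real.sqrt (6 * Real.pi) := Real.sqrt_pos.2 (by positivity)
  have hG₀ : 0 < x ^ (1 - 1 / 10000 : ℝ) / (Real.sqrt (6 * Real.pi) * L) := by positivity
  have hGM : x ^ (1 - 1 / 10000 : ℝ) / (Real.sqrt (6 * Real.pi) * L) ≤
      x ^ α * smoothZeta α y / Real.sqrt (2 * Real.pi * saddlePhi₂ α y) := by
    have h1 : x ^ (1 - 1 / 10000 : ℝ) ≤ x ^ α := Real.rpow_le_rpow_of_exponent_le hx1.le hα4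
    have h2 : 1 ≤ smoothZeta α y := one_le_smoothZeta hα0 y
    have h3 : Real.sqrt (2 * Real.pi * saddlePhi₂ α y) ≤ Real.sqrt (6 * Real.pi) * L := by
      rw [← sqrt_two_pi_three_sq hL0.le]
      exact Real.sqrt_le_sqrt (mul_le_mul_of_nonneg_left hΦ (by positivity))
    have h4 : 0 < Real.sqrt (2 * Real.pi * saddlePhi₂ α y) := Real.sqrt_pos.2 (by positivity)
    calc x ^ (1 - 1 / 10000 : ℝ) / (Real.sqrt (6 * Real.pi) * L) ≤ x ^ α * 1 / (Real.sqrt (6 * Real.pi) * L) := by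
          rw [mul_one]; exact div_le_div_of_nonneg_right h1 (by positivity)
      _ ≤ x ^ α * smoothZeta α y / Real.sqrt (2 * Real.pi * saddlePhi₂ α y) :=
          div_le_div₀ (by positivity) (mul_le_mul_of_nonneg_left h2 (by positivity)) h4 h3
  -- ### the rates
  have hx1' : 1 ≤ x := hx1.le
  obtain ⟨hFle, hΔle, hWle, hηle⟩ := hMAJR x (R : ℝ) y hL3 hx1' hRlo hRhi hRfl hy1 hyK
  have hsle := hMINR x ((R : ℝ) / L ^ B) y hL3 hx1' hRb hy1 hyK
  have hgε : A_M * (Real.log L ^ 2 / L + L ^ (-(1 / 6 : ℝ)) + L ^ (23 * (10 * B + 300) + 3 * B + 200051) * x ^ (-(1 / 20 : ℝ))) ≤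
      ε / 2 := (le_of_lt hg1).trans (min_le_left _ _)
  have hg1' : A_M * (Real.log L ^ 2 / L + L ^ (-(1 / 6 : ℝ)) + L ^ (23 * (10 * B + 300) + 3 * B + 200051) * x ^ (-(1 / 20 : ℝ))) ≤
      1 := (le_of_lt hg1).trans (min_le_right _ _)
  have hη0 : 0 ≤ C_W * (((B + 2 * (10 * B + 300) + 3 : ℕ) : ℝ) + 1) ^ 2 * Real.log (y : ℝ) / L := by positivity
  -- ### apply the explicit form
  have hfin := hEXP x y e₁ e₂ e₃ d₁ d₂ σ (L ^ B) D hxE hy4 hlogy5 hα13 hα1.le hα4 hσ he₁ he₂ he₃ heB₁ heB₂ heB₃ heBx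
    hd₁ hd₂ hd₁e hd₂o hd₁D hd₂D hDx hde hx₁E hy8₁ hy6₁ hy200₁ hα₁ hΨ₁ hx₂E hy8₂ hy6₂ hy200₂ hα₂ hΨ₂ hx₃E hy8₃ hy6₃
    hy200₃ hα₃ hΨ₃ hy8₃' hα' hy107 R ((R : ℝ) ^ 4) _ (L ^ (B + 2 * (10 * B + 300) + 3)) (1 / 100) C_F hR2 hRy hRx hRx10
    heBR hΛR hΛx hη0 (hηle.trans hg1') (by norm_num) hC_F.le hW hFb hE₁ hE₂ hE₃ c₁ c₂ c₃ hc₁ hc₂ hc₃ hp₁ hp₂ hp₃ P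
    (hP₁.trans (le_max_left _ _)) (hP₂.trans (le_max_left _ _)) (hP₃.trans (le_max_left _ _)) H
    ((hHsum R).trans (le_max_left _ _)) _ hG₀ hGM (3 * L ^ 2) hΦ _ _ le_rfl (hΔle.trans hg1') le_rfl (hWle.trans hg1')
  refine hfin.trans ?_
  clear hfin hEXP hW hWx hFb hMAJR hMINR hreg hSC hlt1
  -- ### the two flat errors are `≤ ε/2` each
  set gv : ℝ := Real.log L ^ 2 / L + L ^ (-(1 / 6 : ℝ)) + L ^ (23 * (10 * B + 300) + 3 * B + 200051) * x ^ (-(1 / 20 : ℝ))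
    with hgv
  set sv : ℝ := P * (C_E * Real.log (2 * x) ^ 3 * (y : ℝ) ^ (1 / 4000 : ℝ) * ((R : ℝ) / L ^ B) ^ (-(9 / 20 : ℝ)) *
        (2 * Real.sqrt 5 * Real.sqrt (2 * Real.pi * (3 * L ^ 2))) +
      (164 * (1 + Real.log (2 * x)) ^ 2 * (y : ℝ) ^ 2 * (2 * x) ^ (9 / 10 : ℝ) + 1) * L ^ B /
        (x ^ (1 - 1 / 10000 : ℝ) / (Real.sqrt (6 * Real.pi) * L)) +
      64 * Real.sqrt (2 * Real.pi * (3 * L ^ 2)) / ((R : ℝ) / L ^ B) ^ 2) +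
    8 * Real.sqrt (2 * Real.pi * (3 * L ^ 2)) * P / ((R : ℝ) / L ^ B) ^ 3 with hsv
  have hkey : L ^ 48 * (L ^ B) ^ 2 * sv ≤ ε ^ 2 / (4 * C_E ^ 2) := hsle.trans hg2.le
  set t : ℝ := ε / (2 * C_E * L ^ 24 * L ^ B) with ht
  have ht0 : 0 < t := by positivity
  have hst : sv ≤ t ^ 2 := by
    rw [ht, div_pow, le_div_iff₀ (by positivity)]
    calc sv * (2 * C_E * L ^ 24 * L ^ B) ^ 2 = (4 * C_E ^ 2) * (L ^ 48 * (L ^ B) ^ 2 * sv) := by ring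
      _ ≤ (4 * C_E ^ 2) * (ε ^ 2 / (4 * C_E ^ 2)) := mul_le_mul_of_nonneg_left hkey (by positivity)
      _ = ε ^ 2 := by field_simp
  have hsq : sv ^ (1 / 2 : ℝ) ≤ t := by
    rw [← Real.sqrt_eq_rpow]
    calc Real.sqrt sv ≤ Real.sqrt (t ^ 2) := Real.sqrt_le_sqrt hst
      _ = t := Real.sqrt_sq ht0.le
  have hK : C_E * L ^ 24 * L ^ B * sv ^ (1 / 2 : ℝ) ≤ ε / 2 := by
    calc C_E * L ^ 24 * L ^ B * sv ^ (1 / 2 : ℝ) ≤ C_E * L ^ 24 * L ^ B * t := mul_le_mul_of_nonneg_left hsq (by positivity)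
      _ = ε / 2 := by rw [ht]; field_simp
  have hF2 := hFle.trans hgε
  clear_value gv sv t
  -- ### conclude
  have hm0 : 0 ≤ ((e₁ : ℝ) ^ (-α) * (x ^ α * smoothZeta α y / Real.sqrt (2 * Real.pi * saddlePhi₂ α y))) *
      ((e₂ : ℝ) ^ (-α) * (x ^ α * smoothZeta α y / Real.sqrt (2 * Real.pi * saddlePhi₂ α y))) *
      ((e₃ : ℝ) ^ (-α) * (x ^ α * smoothZeta α y / Real.sqrt (2 * Real.pi * saddlePhi₂ α y))) / (x / e₃) := by
    have := smoothZeta_pos (y := y) hα0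
    positivity
  calc _ ≤ ((e₁ : ℝ) ^ (-α) * (x ^ α * smoothZeta α y / Real.sqrt (2 * Real.pi * saddlePhi₂ α y))) *
      ((e₂ : ℝ) ^ (-α) * (x ^ α * smoothZeta α y / Real.sqrt (2 * Real.pi * saddlePhi₂ α y))) *
      ((e₃ : ℝ) ^ (-α) * (x ^ α * smoothZeta α y / Real.sqrt (2 * Real.pi * saddlePhi₂ α y))) / (x / e₃) * ε :=
        mul_le_mul_of_nonneg_left (by linarith) hm0
    _ = _ := by ring

end SmoothArcs

end Literature.NumberTheory.Sieve

end
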